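import Summits.SmoothPoincare4.SmoothPoincare4.Theorems.ConvexBisectionAcyclicBisectionExistsBeltFibreFraming
import Literature.Topology.FourManifolds.CircleTubeUniqueness
import HarnessLib

/-!
# The framed `r`-longitude of an attaching circle, VI: what a diffeomorphism of `W` extending the
# reflecting diffeotopy of `∂W` does to the sphere tube (stage (3c) of node T3c-1, second half, lemmas)
(node T3c-1 `node_belt_isotopic_pushoff` of the sub-goal T3 of stub `stub_steinRealisation` (NF6), line
`modp-braid-orbits`, crux `ConvexBisection.AcyclicBisectionExists`, item stmt-SmoothPoincare4-10508;
wave 3, worker Z5, lead c5)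

Setting of the tube comparison: an attaching map `h̄ : T → W` of a 2-handle with boundary tube
`Φ₁ = h̄.boundaryTube` (`Φ₁ (ψ, v) = h̄ (depthLine ψ v 0)` as a point of `W`), a second tube `Φ₂` of `∂W`
around the attaching circle whose target is SMALL (`⊆ Φ₁ (𝕊¹ × B(0, 1/4))`), and a diffeomorphism `F`
of `W` which on `∂W` is a map `D₁` with the three properties of the end of the reflecting diffeotopy of
`CircleTube.exists_diffeotopy_reflect`: `D₁ = id` off the target of `Φ₂`,
`D₁ (Φ₁ (ψ, w)) = Φ₂ (ψ, (w₀, s w₁))` for `‖w‖ < r₁`, and `D₁` injective.  Then, with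
`reflFibre s w = (w₀, s w₁)`:

* §1 `reflFibre`; small targets miss the outer shell `1/4 ≤ ‖v‖ < 1` of `Φ₁`
  (`boundaryTube_not_mem_target`); sphere points with fibre `v ≠ 0` are off the core;
* §2 `F` FIXES the outer shell (`apply_sphereTube_of_shell`) together with the fibre framings there
  (`mfderiv_apply_tubeFibreFraming_of_shell`: the fibre arcs stay in the shell), MOVES the inner tube to
  explicit points of `Φ₂` (`apply_sphereTube_of_lt`) and the fibre framings to the velocities of explicit
  arcs in `Φ₂`-coordinates (`mfderiv_apply_tubeFibreFraming_of_lt`), and keeps every sphere point with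
  non-zero fibre inside `h̄(T)` off the core (`apply_sphereTube_mem`);
* §3 registered helper `helper_belt_tubeReflect`.

Everything is proved; no named facts.

## References
* A. A. Kosinski, *Differential Manifolds*, Academic Press (1993), III (3.5), VI §6. [Kosinski1993]
-/

noncomputable section

-- the prescribed namespace `Summit.<P>.<Sub>.…` duplicates `SmoothPoincare4` (P = Sub)
set_option linter.dupNamespace false

open scoped Manifold ContDiff Topology
open Set Function Metric Filter Bundle

namespace Summit.SmoothPoincare4.SmoothPoincare4.Theorems.AcyclicBisectionExists.ModpBraidOrbits

open Literature.Topology.FourManifolds Literature.Topology.FourManifolds.HandleAttachingMap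
  Literature.Geometry.Symplectic

/-! ### §1 The reflected fibre; small targets; sphere points off the core -/

/-- **The reflected fibre** `reflFibre s w = (w₀, s w₁) = w₀ e₀ + s w₁ e₁`. [folklore] -/
def reflFibre (s : ℝ) (w : EuclideanSpace ℝ (Fin 2)) : EuclideanSpace ℝ (Fin 2) :=
  w 0 • planeE0 + (s * w 1) • planeE1

/-- `reflFibre` is additive. [folklore] -/
theorem reflFibre_add (s : ℝ) (v w : EuclideanSpace ℝ (Fin 2)) :
    reflFibre s (v + w) = reflFibre s v + reflFibre s w := by
  ext i; fin_cases i <;> simp [reflFibre, mul_add]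

/-- `reflFibre` is homogeneous. [folklore] -/
theorem reflFibre_smul (s c : ℝ) (w : EuclideanSpace ℝ (Fin 2)) : reflFibre s (c • w) = c • reflFibre s w := by
  ext i; fin_cases i <;> simp [reflFibre, mul_left_comm]

section Reflect

variable {W : Type*} [TopologicalSpace W] [ChartedSpace (EuclideanHalfSpace 4) W]
  [IsManifold (𝓡∂ 4) ∞ W] (f : HandleAttachingMap 3 2 W)

/-- **A small second tube misses the outer shell of the boundary tube**: if
`Φ₂.target ⊆ Φ₁ (𝕊¹ × B(0, 1/4))` then `Φ₁ (ψ, v) ∉ Φ₂.target` for `1/4 ≤ ‖v‖ < 1`. [folklore] -/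
theorem boundaryTube_not_mem_target {Φ₂ : CircleTube ↥((𝓡∂ 4).boundary W)}
    (hsmall : Φ₂.toHomeo.target ⊆ f.boundaryTube.toHomeo ''
      ((univ : Set (sphere (0 : EuclideanSpace ℝ (Fin 2)) 1)) ×ˢ ball (0 : EuclideanSpace ℝ (Fin 2)) (1 / 4)))
    (ψ : sphere (0 : EuclideanSpace ℝ (Fin 2)) 1) {v : EuclideanSpace ℝ (Fin 2)} (hv : 1 / 4 ≤ ‖v‖) (hv1 : ‖v‖ < 1) :
    f.boundaryTube.toHomeo (ψ, v) ∉ Φ₂.toHomeo.target := by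
  intro hmem
  obtain ⟨q, ⟨-, hq⟩, he⟩ := hsmall hmem
  rw [mem_ball_zero_iff] at hq
  have h1 : ((q.1, q.2) : (sphere (0 : EuclideanSpace ℝ (Fin 2)) 1) × EuclideanSpace ℝ (Fin 2)) ∈
      f.boundaryTube.toHomeo.source := f.boundaryTube.mem_source_iff.2 (by linarith)
  have h2 : ((ψ, v) : (sphere (0 : EuclideanSpace ℝ (Fin 2)) 1) × EuclideanSpace ℝ (Fin 2)) ∈
      f.boundaryTube.toHomeo.source := f.boundaryTube.mem_source_iff.2 hv1
  have heq := f.boundaryTube.toHomeo.injOn h1 h2 he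
  have : q.2 = v := congrArg Prod.snd heq
  rw [this] at hq
  linarith

omit [IsManifold (𝓡∂ 4) ∞ W] in
/-- Sphere points with non-zero fibre are off the core. [folklore] -/
theorem apply_depthLine_not_mem_core (ψ : sphere (0 : EuclideanSpace ℝ (Fin 2)) 1) {w : EuclideanSpace ℝ (Fin 2)}
    (hw0 : w ≠ 0) (hw1 : ‖w‖ < 1) : f.toFun (depthLine ψ w 0) ∉ f.core := by
  rw [f.mem_core_iff]
  rintro ⟨y, hy, he⟩
  have hinj := f.isSmoothEmbedding.isEmbedding.injective he
  subst hinj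
  have hpos : 0 < 1 - 0 - ‖w‖ ^ 2 := by nlinarith [norm_nonneg w]
  change lamSq 2 (tubeVec (depthLine ψ w 0)) = 1 at hy
  rw [tubeVec_depthLine _ _ le_rfl hpos, lamSq_mkVec _ _ hpos.le] at hy
  have : ‖w‖ ^ 2 = 0 := by linarith
  exact hw0 (norm_eq_zero.1 (pow_eq_zero_iff (n := 2) (by norm_num) |>.1 this))

/-! ### §2 The effect of the extended reflecting diffeomorphism on the sphere tube -/

variable {Φ₂ : CircleTube ↥((𝓡∂ 4).boundary W)}
  (hcore : ∀ θ, f.boundaryTube.core θ = Φ₂.core θ)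
  (hsmall : Φ₂.toHomeo.target ⊆ f.boundaryTube.toHomeo ''
    ((univ : Set (sphere (0 : EuclideanSpace ℝ (Fin 2)) 1)) ×ˢ ball (0 : EuclideanSpace ℝ (Fin 2)) (1 / 4)))
  (F : W ≃ₘ⟮𝓡∂ 4, 𝓡∂ 4⟯ W) (D₁ : ↥((𝓡∂ 4).boundary W) → ↥((𝓡∂ 4).boundary W))
  (hF : ∀ y : ↥((𝓡∂ 4).boundary W), F (y : W) = ((D₁ y : ↥((𝓡∂ 4).boundary W)) : W))
  (hDout : ∀ y, y ∉ Φ₂.toHomeo.target → D₁ y = y)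
  {s r₁ : ℝ}
  (hD : ∀ (x : sphere (0 : EuclideanSpace ℝ (Fin 2)) 1) (w : EuclideanSpace ℝ (Fin 2)), ‖w‖ < r₁ →
    D₁ (f.boundaryTube.toHomeo (x, w)) = Φ₂.toHomeo (x, reflFibre s w))
  (hinj : Injective D₁)

include hsmall hF hDout in
/-- **`F` fixes the outer shell** `h̄ (depthLine ψ v 0)`, `1/4 ≤ ‖v‖ < 1`. [folklore] -/
theorem apply_sphereTube_of_shell (ψ : sphere (0 : EuclideanSpace ℝ (Fin 2)) 1) {v : EuclideanSpace ℝ (Fin 2)}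
    (hv : 1 / 4 ≤ ‖v‖) (hv1 : ‖v‖ < 1) : F (f.toFun (depthLine ψ v 0)) = f.toFun (depthLine ψ v 0) := by
  have h := hF (f.boundaryTube.toHomeo (ψ, v))
  rw [hDout _ (boundaryTube_not_mem_target f hsmall ψ hv hv1)] at h
  exact h

include hF hD in
/-- **`F` moves the inner tube to explicit points of `Φ₂`**: `F (h̄ (depthLine ψ w 0)) = Φ₂ (ψ, (w₀, s w₁))`
for `‖w‖ < r₁`. [cite: Kosinski1993, III (3.5)] -/
theorem apply_sphereTube_of_lt (ψ : sphere (0 : EuclideanSpace ℝ (Fin 2)) 1) {w : EuclideanSpace ℝ (Fin 2)}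
    (hw : ‖w‖ < r₁) :
    F (f.toFun (depthLine ψ w 0)) = ((Φ₂.toHomeo (ψ, reflFibre s w) : ↥((𝓡∂ 4).boundary W)) : W) := by
  have h := hF (f.boundaryTube.toHomeo (ψ, w))
  rw [hD ψ w hw] at h
  exact h

omit [IsManifold (𝓡∂ 4) ∞ W] in
/-- Chain rule for the fibre framing pushed by `F`: `dF (d/dε|₀ h̄ (fibreArc)) = d/dε|₀ F (h̄ (fibreArc))`
(`‖v‖ < 1`). [folklore] -/
theorem mfderiv_apply_tubeFibreFraming (ψ : sphere (0 : EuclideanSpace ℝ (Fin 2)) 1)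
    {v : EuclideanSpace ℝ (Fin 2)} (hv1 : ‖v‖ < 1) (ζ : EuclideanSpace ℝ (Fin 2)) :
    mfderiv (𝓡∂ 4) (𝓡∂ 4) F (f.toFun (depthLine ψ v 0)) (tubeFibreFraming f ψ v ζ) =
      mfderiv 𝓘(ℝ, ℝ) (𝓡∂ 4) (fun ε : ℝ => F (f.toFun (fibreArc ψ v ζ ε))) 0 (1 : ℝ) := by
  have hγ : MDifferentiableAt 𝓘(ℝ, ℝ) (𝓡∂ 4) (fun ε : ℝ => f.toFun (fibreArc ψ v ζ ε)) 0 :=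
    ((f.isSmoothEmbedding.contMDiff _).comp 0 (contMDiffAt_fibreArc ψ hv1 ζ)).mdifferentiableAt (by simp)
  have hFd : MDifferentiableAt (𝓡∂ 4) (𝓡∂ 4) F (f.toFun (fibreArc ψ v ζ 0)) :=
    (F.contMDiff _).mdifferentiableAt (by simp)
  have hc := mfderiv_comp (0 : ℝ) hFd hγ
  have key : ∀ (y : ↥(handleTube 3 2)) (_ : y = fibreArc ψ v ζ 0),
      mfderiv (𝓡∂ 4) (𝓡∂ 4) F (f.toFun y) (tubeFibreFraming f ψ v ζ) =
        mfderiv (𝓡∂ 4) (𝓡∂ 4) F (f.toFun (fibreArc ψ v ζ 0)) (tubeFibreFraming f ψ v ζ) := by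
    intro y e; subst e; rfl
  rw [key _ (fibreArc_zero ψ v ζ).symm]
  exact (congrArg (fun L : ℝ →L[ℝ] EuclideanSpace ℝ (Fin 4) => L 1) hc).symm

/-- Near `ε = 0` the fibre of the fibre arc stays in an open shell `a < ‖·‖ < b` containing `‖v‖`.
[folklore] -/
theorem eventually_norm_line_mem {v ζ : EuclideanSpace ℝ (Fin 2)} {a b : ℝ} (ha : a < ‖v‖) (hb : ‖v‖ < b) :
    ∀ᶠ ε : ℝ in 𝓝 0, a < ‖v + ε • ζ‖ ∧ ‖v + ε • ζ‖ < b := by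
  have hc : Continuous fun ε : ℝ => ‖v + ε • ζ‖ := by fun_prop
  have h0 : ‖v + (0 : ℝ) • ζ‖ = ‖v‖ := by simp
  have h1 : ∀ᶠ ε : ℝ in 𝓝 0, a < ‖v + ε • ζ‖ :=
    continuousAt_const.eventually_lt hc.continuousAt (by rw [h0]; exact ha)
  have h2 : ∀ᶠ ε : ℝ in 𝓝 0, ‖v + ε • ζ‖ < b :=
    hc.continuousAt.eventually_lt continuousAt_const (by rw [h0]; exact hb)
  exact h1.and h2

include hsmall hF hDout in
/-- **`F` fixes the fibre framings on the open outer shell** `1/4 < ‖v‖ < 1` (the fibre arcs stay in the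
shell for small `ε`, where `F = id`). [folklore] -/
theorem mfderiv_apply_tubeFibreFraming_of_shell (ψ : sphere (0 : EuclideanSpace ℝ (Fin 2)) 1)
    {v : EuclideanSpace ℝ (Fin 2)} (hv : 1 / 4 < ‖v‖) (hv1 : ‖v‖ < 1) (ζ : EuclideanSpace ℝ (Fin 2)) :
    mfderiv (𝓡∂ 4) (𝓡∂ 4) F (f.toFun (depthLine ψ v 0)) (tubeFibreFraming f ψ v ζ) = tubeFibreFraming f ψ v ζ := by
  rw [mfderiv_apply_tubeFibreFraming f F ψ hv1 ζ]
  have hev : (fun ε : ℝ => F (f.toFun (fibreArc ψ v ζ ε))) =ᶠ[𝓝 0] fun ε : ℝ => f.toFun (fibreArc ψ v ζ ε) := by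
    filter_upwards [eventually_norm_line_mem (ζ := ζ) hv hv1] with ε hε
    exact apply_sphereTube_of_shell f hsmall F D₁ hF hDout ψ hε.1.le hε.2
  exact congrArg (fun L : ℝ →L[ℝ] EuclideanSpace ℝ (Fin 4) => L 1) hev.mfderiv_eq

include hF hD in
/-- **`F` moves the fibre framings of the inner tube to the velocities of explicit arcs of `Φ₂`**:
for `‖v‖ < r₁` (and `‖v‖ < 1`),
`dF (tubeFibreFraming h̄ ψ v ζ) = d/dε|₀ Φ₂ (ψ, reflFibre s v + ε reflFibre s ζ)`. [cite: Kosinski1993, III (3.5)] -/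
theorem mfderiv_apply_tubeFibreFraming_of_lt (ψ : sphere (0 : EuclideanSpace ℝ (Fin 2)) 1)
    {v : EuclideanSpace ℝ (Fin 2)} (hv : ‖v‖ < r₁) (hv1 : ‖v‖ < 1) (ζ : EuclideanSpace ℝ (Fin 2)) :
    mfderiv (𝓡∂ 4) (𝓡∂ 4) F (f.toFun (depthLine ψ v 0)) (tubeFibreFraming f ψ v ζ) =
      mfderiv 𝓘(ℝ, ℝ) (𝓡∂ 4) (fun ε : ℝ =>
        ((Φ₂.toHomeo (ψ, reflFibre s v + ε • reflFibre s ζ) : ↥((𝓡∂ 4).boundary W)) : W)) 0 (1 : ℝ) := by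
  rw [mfderiv_apply_tubeFibreFraming f F ψ hv1 ζ]
  have hev : (fun ε : ℝ => F (f.toFun (fibreArc ψ v ζ ε))) =ᶠ[𝓝 0] fun ε : ℝ =>
      ((Φ₂.toHomeo (ψ, reflFibre s v + ε • reflFibre s ζ) : ↥((𝓡∂ 4).boundary W)) : W) := by
    have hc : Continuous fun ε : ℝ => ‖v + ε • ζ‖ := by fun_prop
    have h0 : ‖v + (0 : ℝ) • ζ‖ = ‖v‖ := by simp
    have h2 : ∀ᶠ ε : ℝ in 𝓝 0, ‖v + ε • ζ‖ < r₁ :=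
      hc.continuousAt.eventually_lt continuousAt_const (by rw [h0]; exact hv)
    filter_upwards [h2] with ε hε
    show F (f.toFun (depthLine ψ (v + ε • ζ) 0)) = _
    rw [apply_sphereTube_of_lt f F D₁ hF hD ψ hε, reflFibre_add, reflFibre_smul]
  exact congrArg (fun L : ℝ →L[ℝ] EuclideanSpace ℝ (Fin 4) => L 1) hev.mfderiv_eq

include hcore hsmall hDout hD hinj in
/-- **`D₁` keeps the punctured boundary tube inside the boundary tube, off the core**: for `0 < ‖w‖ < 1`
the point `D₁ (Φ₁ (ψ, w))` is `Φ₁ (ψ', w')` with `0 < ‖w'‖ < 1` (`0 < r₁`). [folklore] -/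
theorem apply_boundaryTube_eq (hr₁ : 0 < r₁) (ψ : sphere (0 : EuclideanSpace ℝ (Fin 2)) 1)
    {w : EuclideanSpace ℝ (Fin 2)} (hw0 : w ≠ 0) (hw1 : ‖w‖ < 1) :
    ∃ (ψ' : sphere (0 : EuclideanSpace ℝ (Fin 2)) 1) (w' : EuclideanSpace ℝ (Fin 2)), w' ≠ 0 ∧ ‖w'‖ < 1 ∧
      D₁ (f.boundaryTube.toHomeo (ψ, w)) = f.boundaryTube.toHomeo (ψ', w') := by
  by_cases hmem : f.boundaryTube.toHomeo (ψ, w) ∈ Φ₂.toHomeo.target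
  · -- inside the small tube: the image stays in the target, hence in `Φ₁ (𝕊¹ × B(0, 1/4))`
    set y := f.boundaryTube.toHomeo (ψ, w) with hy
    have hz : D₁ y ∈ Φ₂.toHomeo.target := by
      by_contra hz
      have h1 : D₁ (D₁ y) = D₁ y := hDout _ hz
      exact hz (by rw [hinj h1]; exact hmem)
    obtain ⟨q, ⟨-, hq⟩, he⟩ := hsmall hz
    rw [mem_ball_zero_iff] at hq
    refine ⟨q.1, q.2, ?_, by linarith, ?_⟩
    · -- `q.2 ≠ 0`: core points are fixed by `D₁`
      intro hq0
      have hq' : q = (q.1, (0 : EuclideanSpace ℝ (Fin 2))) := Prod.ext rfl hq0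
      have hcz : D₁ y = f.boundaryTube.core q.1 := by
        rw [← he, hq']; rfl
      have hfix : D₁ (f.boundaryTube.core q.1) = f.boundaryTube.core q.1 := by
        rw [CircleTube.core_apply, hD q.1 0 (by simpa using hr₁)]
        have : reflFibre s 0 = 0 := by ext i; fin_cases i <;> simp [reflFibre]
        rw [this, ← CircleTube.core_apply, ← CircleTube.core_apply, hcore]
      have hyq : y = f.boundaryTube.core q.1 := hinj (hcz.trans hfix.symm)
      have h1 : ((ψ, w) : (sphere (0 : EuclideanSpace ℝ (Fin 2)) 1) × EuclideanSpace ℝ (Fin 2)) ∈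
          f.boundaryTube.toHomeo.source := f.boundaryTube.mem_source_iff.2 hw1
      have h2 := f.boundaryTube.toHomeo.injOn h1 (f.boundaryTube.mem_source_zero q.1)
        (by rw [hy] at hyq; rw [hyq, CircleTube.core_apply])
      exact hw0 (congrArg Prod.snd h2)
    · rw [← he]
  · exact ⟨ψ, w, hw0, hw1, hDout _ hmem⟩

include hcore hsmall hF hDout hD hinj in
/-- **`F` keeps the punctured sphere tube inside `h̄(T)` off the core.** [folklore] -/
theorem apply_sphereTube_mem (hr₁ : 0 < r₁) (ψ : sphere (0 : EuclideanSpace ℝ (Fin 2)) 1)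
    {w : EuclideanSpace ℝ (Fin 2)} (hw0 : w ≠ 0) (hw1 : ‖w‖ < 1) :
    F (f.toFun (depthLine ψ w 0)) ∈ range f.toFun ∧ F (f.toFun (depthLine ψ w 0)) ∉ f.core := by
  obtain ⟨ψ', w', hw0', hw1', he⟩ := apply_boundaryTube_eq f hcore hsmall D₁ hDout hD hinj hr₁ ψ hw0 hw1
  have h := hF (f.boundaryTube.toHomeo (ψ, w))
  rw [he] at h
  change F (f.toFun (depthLine ψ w 0)) = f.toFun (depthLine ψ' w' 0) at h
  rw [h]
  exact ⟨mem_range_self _, apply_depthLine_not_mem_core f ψ' hw0' hw1'⟩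

end Reflect


/-! ### §3 Registered helper -/

/-- **Registered helper `helper_belt_tubeReflect` (node T3c-1 of NF6 `stub_steinRealisation`, stage (3c)
second half, wave 3, lead c5).**  Let `h̄ : T → W` be a 2-handle attaching map, `Φ₂` a tube of `∂W` with
the core of `h̄.boundaryTube` and target inside `h̄.boundaryTube (𝕊¹ × B(0,1/4))`, and `F` a diffeomorphism
of `W` which on `∂W` is an injective map `D₁` equal to the identity off the target of `Φ₂` and to
`Φ₁ (ψ, w) ↦ Φ₂ (ψ, (w₀, s w₁))` for `‖w‖ < r₁` (`0 < r₁`).  Then `dF` fixes the fibre framings of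
`h̄ (depthLine ψ v 0)` for `1/4 < ‖v‖ < 1`, carries them for `‖v‖ < r₁` to the velocity of
`ε ↦ Φ₂ (ψ, (v₀, s v₁) + ε (ζ₀, s ζ₁))`, and `F` keeps `h̄ (depthLine ψ v 0)` (`v ≠ 0`) inside `h̄(T)` off
the core. [cite: Kosinski1993, III (3.5)] -/
theorem helper_belt_tubeReflect :
    ∀ {W : Type} [TopologicalSpace W] [ChartedSpace (EuclideanHalfSpace 4) W] [IsManifold (𝓡∂ 4) ∞ W]
      (f : Literature.Topology.FourManifolds.HandleAttachingMap 3 2 W)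
      (Φ₂ : Literature.Topology.FourManifolds.CircleTube ↥((𝓡∂ 4).boundary W))
      (_ : ∀ θ, f.boundaryTube.core θ = Φ₂.core θ)
      (_ : Φ₂.toHomeo.target ⊆ f.boundaryTube.toHomeo ''
        ((Set.univ : Set (Metric.sphere (0 : EuclideanSpace ℝ (Fin 2)) 1)) ×ˢ Metric.ball (0 : EuclideanSpace ℝ (Fin 2)) (1 / 4)))
      (F : W ≃ₘ⟮𝓡∂ 4, 𝓡∂ 4⟯ W) (D₁ : ↥((𝓡∂ 4).boundary W) → ↥((𝓡∂ 4).boundary W))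
      (_ : ∀ y : ↥((𝓡∂ 4).boundary W), F (y : W) = ((D₁ y : ↥((𝓡∂ 4).boundary W)) : W))
      (_ : ∀ y, y ∉ Φ₂.toHomeo.target → D₁ y = y) (s r₁ : ℝ) (_ : 0 < r₁)
      (_ : ∀ (x : Metric.sphere (0 : EuclideanSpace ℝ (Fin 2)) 1) (w : EuclideanSpace ℝ (Fin 2)), ‖w‖ < r₁ →
        D₁ (f.boundaryTube.toHomeo (x, w)) = Φ₂.toHomeo (x,
          Summit.SmoothPoincare4.SmoothPoincare4.Theorems.AcyclicBisectionExists.ModpBraidOrbits.reflFibre s w))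
      (_ : Function.Injective D₁)
      (ψ : Metric.sphere (0 : EuclideanSpace ℝ (Fin 2)) 1) (v ζ : EuclideanSpace ℝ (Fin 2)),
      (1 / 4 < ‖v‖ → ‖v‖ < 1 →
        mfderiv (𝓡∂ 4) (𝓡∂ 4) F (f.toFun (Literature.Topology.FourManifolds.depthLine ψ v 0))
          (Summit.SmoothPoincare4.SmoothPoincare4.Theorems.AcyclicBisectionExists.ModpBraidOrbits.tubeFibreFraming f ψ v ζ) =
          Summit.SmoothPoincare4.SmoothPoincare4.Theorems.AcyclicBisectionExists.ModpBraidOrbits.tubeFibreFraming f ψ v ζ) ∧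
      (‖v‖ < r₁ → ‖v‖ < 1 →
        mfderiv (𝓡∂ 4) (𝓡∂ 4) F (f.toFun (Literature.Topology.FourManifolds.depthLine ψ v 0))
          (Summit.SmoothPoincare4.SmoothPoincare4.Theorems.AcyclicBisectionExists.ModpBraidOrbits.tubeFibreFraming f ψ v ζ) =
          mfderiv 𝓘(ℝ, ℝ) (𝓡∂ 4) (fun ε : ℝ => ((Φ₂.toHomeo (ψ,
            Summit.SmoothPoincare4.SmoothPoincare4.Theorems.AcyclicBisectionExists.ModpBraidOrbits.reflFibre s v +
              ε • Summit.SmoothPoincare4.SmoothPoincare4.Theorems.AcyclicBisectionExists.ModpBraidOrbits.reflFibre s ζ) :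
                ↥((𝓡∂ 4).boundary W)) : W)) 0 (1 : ℝ)) ∧
      (v ≠ 0 → ‖v‖ < 1 →
        F (f.toFun (Literature.Topology.FourManifolds.depthLine ψ v 0)) ∈ Set.range f.toFun ∧
          F (f.toFun (Literature.Topology.FourManifolds.depthLine ψ v 0)) ∉ f.core) := by
  intro W _ _ _ f Φ₂ hcore hsmall F D₁ hF hDout s r₁ hr₁ hD hinj ψ v ζ
  exact ⟨fun hv hv1 => mfderiv_apply_tubeFibreFraming_of_shell f hsmall F D₁ hF hDout ψ hv hv1 ζ,
    fun hv hv1 => mfderiv_apply_tubeFibreFraming_of_lt f F D₁ hF hD ψ hv hv1 ζ,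
    fun hv0 hv1 => apply_sphereTube_mem f hcore hsmall F D₁ hF hDout hD hinj hr₁ ψ hv0 hv1⟩

end Summit.SmoothPoincare4.SmoothPoincare4.Theorems.AcyclicBisectionExists.ModpBraidOrbits

end
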